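import Literature.AnabelianGeometry.AbsoluteAnabelian.AbsTopII.TwoTripodNodalDecomposition
import Literature.AnabelianGeometry.SemiGraphs.ProSigmaFreeFactorDisjoint
import Literature.AnabelianGeometry.SemiGraphs.ProSigmaCuspInertia
import Literature.AnabelianGeometry.AbsoluteAnabelian.FreeProlCyclicEncoding
import Literature.GroupTheory.CombinatorialGroupTheory.PuncturedSurfaceGroupFree
import HarnessLib

/-!
# [AbsTopII] Prop 1.3 (vi) and (ix) at the two-vertex nodal DPSC datum: open images in `H`, not open in `Π_H`

S. Mochizuki, *Topics in Absolute Anabelian Geometry II* [AbsTopII] (bib `MochizukiAbsTopII2013`; locators =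
PDF pages of the kurims manuscript `paper:url-585b8d0ad0d9`), §1 Prop 1.3 (vi) p. 12, (ix) p. 12 (proof p. 13);
[CombGC] (`MochizukiCombGC2007`) Rmk 1.1.3 p. 7, Prop 1.2 (i)/(ii) p. 8.

PROOF-ONLY companion of `AbsTopII/TwoTripodNodalDatum.lean` (abc-iut-f-066 gen 5, row «P13-TWO-VERTEX-NODAL-MODEL»),
part 5 (over parts 1–4).  At `M.dpsc` (two tripods `v_A`, `v_B`, ONE non-loop node `e`, cusps `c₁, c₂ | c₃, c₀`,
`H = I ≅ Ẑ^Σ` acting by the Dehn twist; `Π_H = Π_I = P`; every `Σ`):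

* `Dv_eq` — `D_{v_A} = Π_{v_A} · T`, `D_{v_B} = Π_{v_B} · U` (part 4's `decomposition_of_section` with [CombGC]
  Prop 1.2 (ii) for the verticial subgroups);
* `prop13ix_dpsc` — **[AbsTopII] Prop 1.3 (ix) (`DPSCData.Prop13ix`, F-0277) HOLDS, no hypothesis**: the images of
  `D_e = Π_e · T` and `D_c = Π_c · T` / `Π_c · U` in `H = P/Π_𝔾` are ALL of `H` (they contain a section), hence
  open; `D_e`, `D_c` are NOT open in `P`: otherwise `D ∩ Π_𝔾 = Π_e` (resp. `Π_c`), an infinite ABELIAN subgroup,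
  would be open in the slim group `Π_𝔾` ([CombGC] Rmk 1.1.3: pro-`Σ` completions of nonabelian free groups are slim);
* `prop13vi_dpsc` — **[AbsTopII] Prop 1.3 (vi) (`DPSCData.Prop13vi`, F-0279) HOLDS, no hypothesis, with its second
  clause NON-IDLE** (the graph HAS two vertices): the image of `D_v` in `H` is all of `H`; `D_v` is not open in `P`,
  since `D_v ∩ Π_𝔾 = Π_v` meets the (infinite) cusp group of the OTHER component trivially ([CombGC] Prop 1.2 (i):
  disjoint free factors), whereas an open subgroup of `Π_𝔾` meets every infinite subgroup;
* `exists_twoVertex_nodal_model_all` — ONE two-vertex datum carrying the typed (i) ∧ (ii)′ ∧ (iii) ∧ (iii)′ ∧ (iv)′ ∧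
  (iv)-Moreover ∧ (vi) ∧ (vii) ∧ (ix), every nonempty set of primes `Σ`.

HONEST FRAMING: instance at a constructed datum (constructed ≠ geometric); no hypothesis; no side taken on
[IUTchIII] Cor 3.12; typed ≠ proved for the print statements about all stable log curves.
-/

noncomputable section

open scoped Pointwise

namespace Literature.AnabelianGeometry.AbsoluteAnabelian.AbsTopII.TwoTripodNodal.Model

open Literature.AnabelianGeometry.SemiGraphs
open Literature.AnabelianGeometry.SemiGraphs.SemiGraphOfAnabelioids (IsProSigmaCompletion
  infinite_cuspInertia_closure)
open Literature.AnabelianGeometry.SemiGraphs.SemiGraphOfAnabelioids.IsProSigmaCompletion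
open Literature.AnabelianGeometry.Anabelioids (IsSigmaInteger normalizer_le_commensurator)
open Literature.AlgebraicGeometry.Frobenioids (IsSlimGroup)
open Literature.GroupTheory.CombinatorialGroupTheory
open Literature.GroupTheory.CombinatorialGroupTheory.PuncturedSurfaceGroup
open _root_.Topology

variable {Sigma : Set ℕ} (M : Model Sigma)

/-! ### Generic: images in `P/N` of subgroups containing a section; traces on `Π_𝔾` -/

/-- A subgroup `D ⊇ S` with `S · N = P` maps ONTO `P/N`. [cite: MochizukiAbsTopII2013, Prop 1.3 (vi) p.12] -/
theorem map_mk_eq_top_of_section (N : Subgroup M.P) (hN : N.Normal) (S D : Subgroup M.P) (hSN : S ⊔ N = ⊤)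
    (hSD : S ≤ D) : haveI := hN; D.map (QuotientGroup.mk' N) = ⊤ := by
  haveI := hN
  rw [eq_top_iff]
  rintro q -
  obtain ⟨x, rfl⟩ := QuotientGroup.mk'_surjective N q
  have hx : x ∈ ((S ⊔ N : Subgroup M.P) : Set M.P) := by rw [hSN]; exact Subgroup.mem_top x
  rw [Subgroup.mul_normal] at hx
  obtain ⟨s, hs, a, ha, rfl⟩ := Set.mem_mul.mp hx
  refine ⟨s, hSD hs, ?_⟩
  rw [QuotientGroup.mk'_apply, QuotientGroup.mk'_apply, QuotientGroup.eq]
  rwa [inv_mul_cancel_left]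

/-- Hence the image of such a `D` in `P/N` is open (it is everything). [cite: MochizukiAbsTopII2013, Prop 1.3 (vi) p.12] -/
theorem isOpen_map_mk_of_section (N : Subgroup M.P) (hN : N.Normal) (S D : Subgroup M.P) (hSN : S ⊔ N = ⊤)
    (hSD : S ≤ D) : haveI := hN; IsOpen ((D.map (QuotientGroup.mk' N) : Subgroup (M.P ⧸ N)) : Set (M.P ⧸ N)) := by
  haveI := hN
  rw [M.map_mk_eq_top_of_section N hN S D hSN hSD, Subgroup.coe_top]
  exact isOpen_univ

/-- The trace on `Π_𝔾` of `ι(K₀) · S` is `K₀` when `(ι(K₀) · S) ∩ Π_𝔾 = ι(K₀)`. [cite: MochizukiAbsTopII2013, Prop 1.3 (ix) p.12] -/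
theorem comap_subtype_eq_of_inf (K₀ : Subgroup ↥M.PiG) (D : Subgroup M.P) (hD : D ⊓ M.PiG = K₀.map M.PiG.subtype) :
    D.comap M.PiG.subtype = K₀ := by
  ext x
  constructor
  · intro hx
    have : (x : M.P) ∈ D ⊓ M.PiG := ⟨hx, x.2⟩
    rw [hD] at this
    obtain ⟨y, hy, hyx⟩ := this
    rwa [← Subtype.val_injective hyx]
  · intro hx
    have : (x : M.P) ∈ K₀.map M.PiG.subtype := ⟨x, hx, rfl⟩
    rw [← hD] at this
    exact this.1

/-- **`Π_𝔾` is slim** (pro-`Σ` completion of the nonabelian free group `Γ_{0,4}`; [CombGC] Rmk 1.1.3, [AbsAnab]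
Lem 1.3.1). [cite: MochizukiCombGC2007, Rmk 1.1.3 p.7] -/
theorem isSlimGroup_PiG : IsSlimGroup ↥M.PiG := by
  obtain ⟨b, -⟩ := exists_freeGroupBasis_node
  haveI : IsFreeGroup (PuncturedSurfaceGroup 0 4) := b.isFreeGroup
  haveI : CompactSpace ↥M.PiG := isCompact_iff_compactSpace.mp M.isClosed_PiG.isCompact
  have h04 : PuncturedSurfaceGroup.IsHyperbolicType 0 (3 + 1) := by
    unfold PuncturedSurfaceGroup.IsHyperbolicType; norm_num
  exact isSlimGroup (PuncturedSurfaceGroup.exists_mul_ne_mul h04) M.isProSigmaCompletion_κG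

/-- An infinite ABELIAN closed subgroup `K₀` of the slim group `Π_𝔾` is not the trace of an open subgroup of `P`.
[cite: MochizukiAbsTopII2013, Prop 1.3 (ix) p.12] -/
theorem not_isOpen_of_comap_abelian (K₀ : Subgroup ↥M.PiG) (hinf : Infinite K₀)
    (hab : ∀ a ∈ K₀, ∀ b ∈ K₀, a * b = b * a) (D : Subgroup M.P) (hD : D.comap M.PiG.subtype = K₀) :
    ¬ IsOpen (D : Set M.P) := by
  intro hopen
  have hK₀open : IsOpen (K₀ : Set ↥M.PiG) := by
    rw [← hD]; exact hopen.preimage continuous_subtype_val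
  have hZ := M.isSlimGroup_PiG.centralizer_eq_bot K₀ hK₀open
  have hle : K₀ ≤ Subgroup.centralizer (K₀ : Set ↥M.PiG) := fun a ha =>
    Subgroup.mem_centralizer_iff.mpr fun b hb => (hab a ha b hb).symm
  rw [hZ, le_bot_iff] at hle
  haveI : Finite ↥K₀ := by rw [hle]; infer_instance
  exact not_finite ↥K₀

/-- A closed subgroup `K₀ ⊆ Π_𝔾` meeting an INFINITE subgroup `C` trivially is not the trace of an open subgroup of
`P` (an open subgroup of the profinite pro-`Σ` group `Π_𝔾` has `Σ`-integer, hence finite positive, index in `C`).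
[cite: MochizukiAbsTopII2013, Prop 1.3 (vi) p.12] -/
theorem not_isOpen_of_comap_inf_eq_bot (K₀ C : Subgroup ↥M.PiG) (hC : Infinite C) (hKC : K₀ ⊓ C = ⊥)
    (D : Subgroup M.P) (hD : D.comap M.PiG.subtype = K₀) : ¬ IsOpen (D : Set M.P) := by
  haveI := hC
  intro hopen
  haveI : CompactSpace ↥M.PiG := isCompact_iff_compactSpace.mp M.isClosed_PiG.isCompact
  have hK₀open : IsOpen (K₀ : Set ↥M.PiG) := by
    rw [← hD]; exact hopen.preimage continuous_subtype_val
  have hidx : IsSigmaInteger Sigma (K₀.subgroupOf C).index :=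
    isSigmaInteger_index_of_isOpen_of_isProSigma M.isProSigma_PiG C (K₀.subgroupOf C)
      (hK₀open.preimage continuous_subtype_val)
  have hne : K₀.relIndex C ≠ 0 := by
    rw [Subgroup.relIndex]; exact hidx.1.ne'
  exact inf_ne_bot_of_relIndex_ne_zero_of_infinite hne hKC

/-! ### `D_v = Π_v · T` resp. `Π_v · U` -/

/-- **`D_{v_A} = Π_{v_A} · T`** (free-factor commensurable terminality + the section `T` centralising `Π_{v_A}`).
[cite: MochizukiAbsTopII2013, Prop 1.3 (v) p.12] -/
theorem Dv_zero_eq (hne : Sigma.Nonempty) (hprime : ∀ p ∈ Sigma, p.Prime) :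
    (M.dpsc hne hprime).Dv ⟨(0 : Fin 2)⟩ = (M.vertGpA).map M.PiG.subtype ⊔ M.T := by
  have hK : Subgroup.Commensurable.commensurator ((M.vertGpA).map M.PiG.subtype) ⊓ M.PiG ≤ (M.vertGpA).map M.PiG.subtype := by
    have h : Subgroup.Commensurable.commensurator ((M.vertGpA).map M.PiG.subtype) ⊓ M.PiG.subtype.range ≤
        (M.vertGpA).map M.PiG.subtype :=
      (isCommensurablyTerminal_subgroupOf_iff ((M.dpsc hne hprime).vertSub_le ⟨(0 : Fin 2)⟩)).mp
        (M.isCommensurablyTerminal_vertSub hne hprime ⟨(0 : Fin 2)⟩)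
    rwa [Subgroup.range_subtype] at h
  exact (M.decomposition_of_section _ _ hK M.T_le_centralizer_vertGpA (by rw [sup_comm]; exact M.PiG_sup_T)).1

/-- **`D_{v_B} = Π_{v_B} · U`**. [cite: MochizukiAbsTopII2013, Prop 1.3 (v) p.12] -/
theorem Dv_one_eq (hne : Sigma.Nonempty) (hprime : ∀ p ∈ Sigma, p.Prime) :
    (M.dpsc hne hprime).Dv ⟨(1 : Fin 2)⟩ = (M.vertGpB).map M.PiG.subtype ⊔ M.U := by
  have hK : Subgroup.Commensurable.commensurator ((M.vertGpB).map M.PiG.subtype) ⊓ M.PiG ≤ (M.vertGpB).map M.PiG.subtype := by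
    have h : Subgroup.Commensurable.commensurator ((M.vertGpB).map M.PiG.subtype) ⊓ M.PiG.subtype.range ≤
        (M.vertGpB).map M.PiG.subtype :=
      (isCommensurablyTerminal_subgroupOf_iff ((M.dpsc hne hprime).vertSub_le ⟨(1 : Fin 2)⟩)).mp
        (M.isCommensurablyTerminal_vertSub hne hprime ⟨(1 : Fin 2)⟩)
    rwa [Subgroup.range_subtype] at h
  exact (M.decomposition_of_section _ _ hK M.U_le_centralizer_vertGpB M.U_sup_PiG).1

/-! ### Prop 1.3 (ix) -/

/-- The data common to the node and the cusps: for `K₀ ⊆ Π_𝔾` infinite abelian and commensurably terminal, and a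
section `S` centralising `ι(K₀)`, the subgroup `D := N(ι K₀) = ι(K₀) · S` maps onto `P/Π_𝔾` and is not open.
[cite: MochizukiAbsTopII2013, Prop 1.3 (ix) p.12] -/
theorem image_open_not_open (hne : Sigma.Nonempty) (hprime : ∀ p ∈ Sigma, p.Prime) (K₀ : Subgroup ↥M.PiG)
    (hinf : Infinite K₀) (hab : ∀ a ∈ K₀, ∀ b ∈ K₀, a * b = b * a)
    (hK : Subgroup.Commensurable.commensurator (K₀.map M.PiG.subtype) ⊓ M.PiG ≤ K₀.map M.PiG.subtype)
    (S : Subgroup M.P) (hS : S ≤ Subgroup.centralizer ((K₀.map M.PiG.subtype : Subgroup M.P) : Set M.P))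
    (hSG : S ⊔ M.PiG = ⊤) (hSbot : S ⊓ M.PiG = ⊥) :
    haveI := (M.dpsc hne hprime).normal_PiG
    IsOpen (((Subgroup.normalizer ((K₀.map M.PiG.subtype : Subgroup M.P) : Set M.P)).map
        (QuotientGroup.mk' (M.dpsc hne hprime).PiG) : Subgroup (M.P ⧸ (M.dpsc hne hprime).PiG)) :
          Set (M.P ⧸ (M.dpsc hne hprime).PiG)) ∧
      ¬ IsOpen ((Subgroup.normalizer ((K₀.map M.PiG.subtype : Subgroup M.P) : Set M.P) : Subgroup M.P) : Set M.P) := by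
  haveI hNn : @Subgroup.Normal M.P _ (M.dpsc hne hprime).PiG := (M.dpsc hne hprime).normal_PiG
  obtain ⟨hN, -⟩ := M.decomposition_of_section _ S hK hS hSG
  have hSG' : S ⊔ (M.dpsc hne hprime).PiG = ⊤ := by rw [dpsc_PiG]; exact hSG
  constructor
  · rw [hN]
    exact M.isOpen_map_mk_of_section _ hNn S _ hSG' le_sup_right
  · rw [hN]
    refine M.not_isOpen_of_comap_abelian K₀ hinf hab _ (M.comap_subtype_eq_of_inf K₀ _ ?_)
    exact M.sup_inf_PiG_eq_of_section _ S (Subgroup.map_subtype_le _) hS hSbot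

/-- `Π_e` (inside `Π_𝔾`) is infinite and abelian. [cite: MochizukiCombGC2007, Rmk 1.1.3 p.7] -/
theorem nodeGp_infinite_abelian (hne : Sigma.Nonempty) (hprime : ∀ p ∈ Sigma, p.Prime) :
    Infinite ↥M.nodeGp ∧ ∀ a ∈ M.nodeGp, ∀ b ∈ M.nodeGp, a * b = b * a := by
  haveI : CompactSpace ↥M.PiG := isCompact_iff_compactSpace.mp M.isClosed_PiG.isCompact
  obtain ⟨b, hb0, hb1, hb2⟩ := exists_freeGroupBasis_node
  have hp : ∃ p ∈ Sigma, p.Prime := by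
    obtain ⟨p, hp⟩ := hne; exact ⟨p, hp, hprime p hp⟩
  have hinf := infinite_freeFactor b {1} ⟨1, rfl⟩ M.isProSigmaCompletion_κG hp
  rw [Set.image_singleton, hb1, ← Subgroup.zpowers_eq_closure] at hinf
  refine ⟨hinf, fun a ha b' hb' => ?_⟩
  have hcomm : ∀ u v : ↥((Subgroup.zpowers (c 1 * c 2 : PuncturedSurfaceGroup 0 4)).map M.κG), u * v = v * u := by
    rintro ⟨u, hu⟩ ⟨v, hv⟩
    rw [MonoidHom.map_zpowers] at hu hv
    obtain ⟨k, rfl⟩ := Subgroup.mem_zpowers_iff.mp hu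
    obtain ⟨l, rfl⟩ := Subgroup.mem_zpowers_iff.mp hv
    exact Subtype.ext (zpow_mul_comm _ k l)
  letI := Subgroup.commGroupTopologicalClosure _ hcomm
  exact congrArg Subtype.val (mul_comm
    (⟨a, ha⟩ : ↥(((Subgroup.zpowers (c 1 * c 2 : PuncturedSurfaceGroup 0 4)).map M.κG).topologicalClosure)) ⟨b', hb'⟩)

/-- `Π_{c_j}` (inside `Π_𝔾`) is infinite and abelian. [cite: MochizukiCombGC2007, Rmk 1.1.3 p.7] -/
theorem cuspGp_infinite_abelian (hne : Sigma.Nonempty) (hprime : ∀ p ∈ Sigma, p.Prime) (j : Fin 4) :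
    Infinite ↥(M.cuspGp j) ∧ ∀ a ∈ M.cuspGp j, ∀ b ∈ M.cuspGp j, a * b = b * a := by
  have h04 : PuncturedSurfaceGroup.IsHyperbolicType 0 4 := by
    unfold PuncturedSurfaceGroup.IsHyperbolicType; norm_num
  refine ⟨infinite_cuspInertia_closure hne hprime h04 M.κG M.isProSigmaCompletion_κG j, fun a ha b' hb' => ?_⟩
  have hcomm : ∀ u v : ↥((PuncturedSurfaceGroup.cuspInertia (g := 0) j).map M.κG), u * v = v * u := by
    rintro ⟨u, hu⟩ ⟨v, hv⟩
    rw [PuncturedSurfaceGroup.cuspInertia, MonoidHom.map_zpowers] at hu hv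
    obtain ⟨k, rfl⟩ := Subgroup.mem_zpowers_iff.mp hu
    obtain ⟨l, rfl⟩ := Subgroup.mem_zpowers_iff.mp hv
    exact Subtype.ext (zpow_mul_comm _ k l)
  letI := Subgroup.commGroupTopologicalClosure _ hcomm
  exact congrArg Subtype.val (mul_comm
    (⟨a, ha⟩ : ↥(((PuncturedSurfaceGroup.cuspInertia (g := 0) j).map M.κG).topologicalClosure)) ⟨b', hb'⟩)

/-- **[AbsTopII] Prop 1.3 (ix) (`DPSCData.Prop13ix`, F-0277) HOLDS at the two-vertex nodal DPSC datum, every `Σ`, no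
hypothesis**: the images of `D_e`, `D_c` in `H` are open (all of `H`); `D_e`, `D_c` are not open in `Π_H`.
[cite: MochizukiAbsTopII2013, Prop 1.3 (ix) p.12] -/
theorem prop13ix_dpsc (hne : Sigma.Nonempty) (hprime : ∀ p ∈ Sigma, p.Prime) :
    Literature.AnabelianGeometry.AbsoluteAnabelian.DPSCData.Prop13ix (M.dpsc hne hprime).toDPSCData := by
  have hTbot : M.T ⊓ M.PiG = ⊥ := by
    rw [Model.T, Model.PiG]; exact SemidirectCofinal.closure_inr_inf_closure_inl_eq_bot M.φ M.isProSigmaCompletion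
  have hTsup : M.T ⊔ M.PiG = ⊤ := by rw [sup_comm]; exact M.PiG_sup_T
  refine ⟨fun e => ?_, fun e => ?_⟩
  · -- the node: `K₀ = Π_e`, `S = T`
    obtain ⟨hinf, hab⟩ := M.nodeGp_infinite_abelian hne hprime
    have hK : Subgroup.Commensurable.commensurator ((M.nodeGp).map M.PiG.subtype) ⊓ M.PiG ≤ (M.nodeGp).map M.PiG.subtype := by
      have h : Subgroup.Commensurable.commensurator ((M.nodeGp).map M.PiG.subtype) ⊓ M.PiG.subtype.range ≤
          (M.nodeGp).map M.PiG.subtype :=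
        (isCommensurablyTerminal_subgroupOf_iff ((M.dpsc hne hprime).nodeSub_le e)).mp
          (M.isCommensurablyTerminal_nodeSub hne hprime e)
      rwa [Subgroup.range_subtype] at h
    have hS : M.T ≤ Subgroup.centralizer (((M.nodeGp).map M.PiG.subtype : Subgroup M.P) : Set M.P) := fun t ht => by
      rw [Subgroup.mem_centralizer_iff]
      intro a ha
      exact M.W_commute_T a ha t ht
    exact M.image_open_not_open hne hprime M.nodeGp hinf hab hK M.T hS hTsup hTbot
  · -- the cusps: `K₀ = Π_{c_j}`, `S = T` (`j = 1, 2`) resp. `U` (`j = 3, 0`)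
    rcases e with ⟨j⟩
    obtain ⟨hinf, hab⟩ := M.cuspGp_infinite_abelian hne hprime j
    have hK : Subgroup.Commensurable.commensurator ((M.cuspGp j).map M.PiG.subtype) ⊓ M.PiG ≤ (M.cuspGp j).map M.PiG.subtype := by
      have h : Subgroup.Commensurable.commensurator ((M.cuspGp j).map M.PiG.subtype) ⊓ M.PiG.subtype.range ≤
          (M.cuspGp j).map M.PiG.subtype :=
        (isCommensurablyTerminal_subgroupOf_iff ((M.dpsc hne hprime).cuspSub_le ⟨j⟩)).mp
          (M.isCommensurablyTerminal_cuspSub hne hprime ⟨j⟩)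
      rwa [Subgroup.range_subtype] at h
    fin_cases j
    · exact M.image_open_not_open hne hprime (M.cuspGp 0) hinf hab hK M.U (M.U_le_centralizer_cuspGp M.twist_c_zero)
        M.U_sup_PiG (M.U_inf_PiG hne hprime)
    · exact M.image_open_not_open hne hprime (M.cuspGp 1) hinf hab hK M.T (M.T_le_centralizer_cuspGp M.twist_c_one) hTsup hTbot
    · exact M.image_open_not_open hne hprime (M.cuspGp 2) hinf hab hK M.T (M.T_le_centralizer_cuspGp M.twist_c_two) hTsup hTbot
    · exact M.image_open_not_open hne hprime (M.cuspGp 3) hinf hab hK M.U (M.U_le_centralizer_cuspGp M.twist_c_three)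
        M.U_sup_PiG (M.U_inf_PiG hne hprime)

/-! ### Prop 1.3 (vi) -/

/-- `Π_{v_A} ∩ Π_{c₃} = {1}` and `Π_{v_B} ∩ Π_{c₁} = {1}` inside `Π_𝔾` (disjoint free factors `{c₁, c₁c₂}` / `{c₃}` and
`{c₁c₂, c₃}` / `{c₁}`). [cite: MochizukiCombGC2007, Prop 1.2(i) p.8] -/
theorem vertGp_inf_cuspGp_eq_bot :
    M.vertGpA ⊓ M.cuspGp 3 = ⊥ ∧ M.vertGpB ⊓ M.cuspGp 1 = ⊥ := by
  haveI : CompactSpace ↥M.PiG := isCompact_iff_compactSpace.mp M.isClosed_PiG.isCompact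
  obtain ⟨b, hb0, hb1, hb2⟩ := exists_freeGroupBasis_node
  have hA : M.vertGpA = ((Subgroup.closure (b '' {0, 1})).map M.κG).topologicalClosure := by
    rw [Set.image_pair, hb0, hb1]; rfl
  have hB : M.vertGpB = ((Subgroup.closure (b '' {1, 2})).map M.κG).topologicalClosure := by
    rw [Set.image_pair, hb1, hb2]; rfl
  have hC3 : M.cuspGp 3 = ((Subgroup.closure (b '' {2})).map M.κG).topologicalClosure := by
    rw [Set.image_singleton, hb2, ← Subgroup.zpowers_eq_closure]; rfl
  have hC1 : M.cuspGp 1 = ((Subgroup.closure (b '' {0})).map M.κG).topologicalClosure := by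
    rw [Set.image_singleton, hb0, ← Subgroup.zpowers_eq_closure]; rfl
  constructor
  · have h := freeFactor_inf_conj_eq_bot_of_disjoint b {0, 1} {2} (by simp) M.isProSigmaCompletion_κG 1
    rw [map_one, one_smul] at h
    rw [hA, hC3]; exact h
  · have h := freeFactor_inf_conj_eq_bot_of_disjoint b {1, 2} {0} (by simp) M.isProSigmaCompletion_κG 1
    rw [map_one, one_smul] at h
    rw [hB, hC1]; exact h

/-- **[AbsTopII] Prop 1.3 (vi) (`DPSCData.Prop13vi`, F-0279) HOLDS at the two-vertex nodal DPSC datum, every `Σ`,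
no hypothesis, with the second clause NON-IDLE** (there IS another vertex): the image of `D_v` in `H` is all of
`H`; `D_v` is not open in `Π_H` (`D_v ∩ Π_𝔾 = Π_v` misses the infinite cusp group of the other component).
[cite: MochizukiAbsTopII2013, Prop 1.3 (vi) p.12] -/
theorem prop13vi_dpsc (hne : Sigma.Nonempty) (hprime : ∀ p ∈ Sigma, p.Prime) :
    Literature.AnabelianGeometry.AbsoluteAnabelian.DPSCData.Prop13vi (M.dpsc hne hprime).toDPSCData := by
  haveI hNn : @Subgroup.Normal M.P _ (M.dpsc hne hprime).PiG := (M.dpsc hne hprime).normal_PiG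
  have h04 : PuncturedSurfaceGroup.IsHyperbolicType 0 4 := by
    unfold PuncturedSurfaceGroup.IsHyperbolicType; norm_num
  have hTbot : M.T ⊓ M.PiG = ⊥ := by
    rw [Model.T, Model.PiG]; exact SemidirectCofinal.closure_inr_inf_closure_inl_eq_bot M.φ M.isProSigmaCompletion
  have hTsup' : M.T ⊔ (M.dpsc hne hprime).PiG = ⊤ := by rw [dpsc_PiG, sup_comm]; exact M.PiG_sup_T
  have hUsup' : M.U ⊔ (M.dpsc hne hprime).PiG = ⊤ := by rw [dpsc_PiG]; exact M.U_sup_PiG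
  obtain ⟨hA3, hB1⟩ := M.vertGp_inf_cuspGp_eq_bot
  intro v
  rcases M.vert_cases hne hprime v with rfl | rfl
  · rw [Dv_zero_eq]
    refine ⟨?_, fun _ => ?_⟩
    · exact M.isOpen_map_mk_of_section _ hNn M.T _ hTsup' le_sup_right
    · refine M.not_isOpen_of_comap_inf_eq_bot M.vertGpA (M.cuspGp 3)
        (infinite_cuspInertia_closure hne hprime h04 M.κG M.isProSigmaCompletion_κG (3 : Fin 4)) hA3 _
        (M.comap_subtype_eq_of_inf _ _ ?_)
      exact M.sup_inf_PiG_eq_of_section _ _ (Subgroup.map_subtype_le _) M.T_le_centralizer_vertGpA hTbot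
  · rw [Dv_one_eq]
    refine ⟨?_, fun _ => ?_⟩
    · exact M.isOpen_map_mk_of_section _ hNn M.U _ hUsup' le_sup_right
    · refine M.not_isOpen_of_comap_inf_eq_bot M.vertGpB (M.cuspGp 1)
        (infinite_cuspInertia_closure hne hprime h04 M.κG M.isProSigmaCompletion_κG (1 : Fin 4)) hB1 _
        (M.comap_subtype_eq_of_inf _ _ ?_)
      exact M.sup_inf_PiG_eq_of_section _ _ (Subgroup.map_subtype_le _) M.U_le_centralizer_vertGpB (M.U_inf_PiG hne hprime)

/-- **ONE DPSC datum WITH TWO VERTICES carrying the typed [AbsTopII] Prop 1.3 (i) ∧ (ii)′ ∧ (iii) ∧ (iii)′ ∧ (iv)′ ∧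
(iv)-«Moreover» ∧ (vi) ∧ (vii) ∧ (ix), for every nonempty set of primes `Σ`.** [cite: MochizukiAbsTopII2013, Prop 1.3 p.11] -/
theorem exists_twoVertex_nodal_model_all (Sigma : Set ℕ) (hne : Sigma.Nonempty) (hprime : ∀ p ∈ Sigma, p.Prime) :
    ∃ X : DPSCIndexData.{0}, X.Sigma = Sigma ∧ (∃ v v' : X.Vert, v ≠ v' ∧ X.Adjacent v v') ∧ Nonempty X.Node ∧
      Literature.AnabelianGeometry.AbsoluteAnabelian.AbsTopII.DPSCIndexData.Prop_1_3_i X ∧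
      Literature.AnabelianGeometry.AbsoluteAnabelian.AbsTopII.DPSCIndexData.Prop_1_3_ii' X ∧
      Literature.AnabelianGeometry.AbsoluteAnabelian.DPSCData.Prop13iii X.toDPSCData ∧
      Literature.AnabelianGeometry.AbsoluteAnabelian.AbsTopII.DPSCIndexData.Prop_1_3_iii' X ∧
      Literature.AnabelianGeometry.AbsoluteAnabelian.DPSCData.Prop13iv' X.toDPSCData ∧
      Literature.AnabelianGeometry.AbsoluteAnabelian.DPSCData.Prop13iv_moreover X.toDPSCData ∧
      Literature.AnabelianGeometry.AbsoluteAnabelian.DPSCData.Prop13vi X.toDPSCData ∧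
      Literature.AnabelianGeometry.AbsoluteAnabelian.DPSCData.Prop13vii X.toDPSCData ∧
      Literature.AnabelianGeometry.AbsoluteAnabelian.DPSCData.Prop13ix X.toDPSCData := by
  obtain ⟨M⟩ := Model.nonempty Sigma
  exact ⟨M.dpsc hne hprime, rfl, ⟨⟨(0 : Fin 2)⟩, ⟨(1 : Fin 2)⟩, M.vert_zero_ne_one hne hprime, M.adjacent_dpsc hne hprime _ _⟩,
    ⟨⟨()⟩⟩, M.prop_1_3_i_dpsc hne hprime, M.prop_1_3_ii'_dpsc hne hprime, M.prop13iii_dpsc hne hprime,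
    M.prop_1_3_iii'_dpsc hne hprime, M.prop13iv'_dpsc hne hprime, M.prop13iv_moreover_dpsc hne hprime,
    M.prop13vi_dpsc hne hprime, M.prop13vii_dpsc hne hprime, M.prop13ix_dpsc hne hprime⟩

end Literature.AnabelianGeometry.AbsoluteAnabelian.AbsTopII.TwoTripodNodal.Model

end
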